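import Mathlib
import HarnessLib
import Summits.NavierStokesRegularity.NavierStokesRegularity.Theorems.PoloidalWindowDoorPoloidalWindowRigidityLocalVorticitySymmetry
import Summits.NavierStokesRegularity.NavierStokesRegularity.Theorems.PoloidalWindowDoorPoloidalWindowRigidityDegenerateSlice

/-!
# Route `PoloidalWindowDoor`, crux `PoloidalWindowRigidity` (K2, stmt-NavierStokesRegularity-19708) — line «lrc-jet»
# (DIRECTOR-NS g7 #20: LRC′ IS THE LINE): THE COMPOSITION `K2 ⇐ LRC′` — a class-specialised, space–time form of the
# K2 lead's LOCAL RIGIDITY CONJECTURE LRC′ implies that a poloidal profile is not backward-singular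

Cell ns-regularity-ideate, seat ns-poloidal-K2-p3 gen 3 (stub-worker under the K2 lead ns-poloidal-K2-p1 g3; file landed
`--supports stmt-NavierStokesRegularity-19708` as a helper; the lead registers the line and names the stubs).

LRC′ (K2P1-LOCAL-NOTES v3/v4 §10, LINE-PROPOSAL-lrc-jet): «an analytic poloidal Navier–Stokes germ with `ω ≠ 0` and Clebsch
slope `Λ ∉ {0,1}` on an open set has a VORTICITY with a one-parameter horizontal isometry group (translations — stratum A,
or rotations about a vertical axis — stratum A′)».  In the route's vocabulary (`Λ = 0 ⇔ ∇_h v₂ = 0`, `Λ = 1 ⇔ ∂₂v_h = 0`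
on `{ω ≠ 0}`, nsreg-p7 g7 `…SymmetryGerms` / `…VerticalShearGerm`) and for a profile `v` of the Type-I class, the
hypothesis `hLRC` below is LRC′ SPECIALISED TO `v` AND READ ON OPEN SPACE–TIME SETS: for every nonempty open `W` in the
backward slab on which `curl v ≠ 0`, `∇_h v₂ ≠ 0`, `∂₂v_h ≠ 0` pointwise, some nonempty open `W′ ⊆ W` carries either a
direction `e ≠ 0` with `D(curl v(s))(y)[e] = 0` or a vertical axis `c + ℝe₃` with `D(curl v(s))(y)[J(y−c)] = J curl v(s)(y)`.
* `nonflatLiouville_of_lrc` — **class + poloidal (all slices) + `hLRC` ⇒ `¬ IsBackwardSingularPoint v 0`.**  Proof = the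
  lead's case split on the slice `s = −1`: if every point of the slice is DEGENERATE (`ω = 0 ∨ ∇_h v₂ = 0 ∨ ∂₂v_h = 0`)
  then p7 g7's `nonflatLiouville_of_pointwise_degenerate_slice` (p510531); otherwise the non-degenerate part of the slab is
  a nonempty open space–time set (joint analyticity ⇒ continuity of `curl v` and `Dv`), LRC′ applies, and the two symmetry
  branches are this seat's `nonflatLiouville_of_local_curl_translation` / `…_rotation` (p509715).
So the skeleton stub `stub_k2OfLrc` of the proposed line is this theorem once LRC′ is stated in (or implies) the
space–time form; a ONE-SLICE rotational conclusion would NOT suffice with tree tools (A′ consumes every slice).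

WHAT THIS IS NOT: not a claim about Navier–Stokes regularity and not LRC′ — the routine half of the line, sorry-free
(bears_on LADDER-NS N0 via crux K2 = stmt-19708).
-/

noncomputable section

-- the summit and its single sub-problem share the name (CONVENTIONS §1), as in every Theorems file
set_option linter.dupNamespace false

namespace Summit.NavierStokesRegularity.NavierStokesRegularity.Theorems.PoloidalWindowDoorPoloidalWindowRigidityK2OfLrc

open Set Function Filter Topology Metric
open scoped RealInnerProductSpace InnerProductSpace
open Literature.Analysis Literature.Analysis.FluidPDE
open Summit.NavierStokesRegularity.NavierStokesRegularity.Theorems.LocalSineTubeDoorProfileAlignedWindowRigidityAncient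
open Summit.NavierStokesRegularity.NavierStokesRegularity.Theorems.TubeAlternative.AnalyticPropagation
open Summit.NavierStokesRegularity.NavierStokesRegularity.Theorems.PoloidalWindowDoorPoloidalWindowRigidityLocalVorticitySymmetry
open Summit.NavierStokesRegularity.NavierStokesRegularity.Theorems.PoloidalWindowDoorPoloidalWindowRigidityDegenerateSlice

variable {C : ℝ} {v : ℝ → EuclideanSpace ℝ (Fin 3) → EuclideanSpace ℝ (Fin 3)}

/-- **`K2 ⇐ LRC′` (class-specialised, space–time form).**  Let `v` be a profile of the route's Type-I class, poloidal
along `e₃` on every slice.  Suppose LRC′ holds for `v` in the following form: for every nonempty open `W` contained in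
the backward slab `(−∞,0) × ℝ³` on which, pointwise, `curl v(s)(y) ≠ 0`, `∇_h v₂(s,y) ≠ 0` and `∂₂v_h(s,y) ≠ 0`, there
is a nonempty open `W′ ⊆ W` on which EITHER `D(curl v(s))(y)[e] = 0` for one fixed `e ≠ 0` OR
`D(curl v(s))(y)[J(y − c)] = J curl v(s)(y)` for one fixed `c`.  Then `v` is not backward-singular at the apex. -/
theorem nonflatLiouville_of_lrc (hrate : HasTypeITimeDecay C v)
    (hcont : ContinuousOn (uncurry v) (Iio (0 : ℝ) ×ˢ univ))
    (hmild : ∀ s t : ℝ, s < t → t < 0 → ∀ x,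
      v t x = UnboundedOperators.heatExtension (v s) (t - s) x - oseenDuhamel 1 s v v t x)
    (hdiv : ∀ t < 0, VectorCalculus.IsDivFree (v t))
    (hpol : ∀ s < 0, ∀ y, ⟪curl (v s) y, EuclideanSpace.single 2 1⟫_ℝ = 0)
    (hLRC : ∀ W : Set (ℝ × EuclideanSpace ℝ (Fin 3)), IsOpen W → W.Nonempty → W ⊆ Iio (0 : ℝ) ×ˢ univ →
      (∀ z ∈ W, curl (v z.1) z.2 ≠ 0 ∧
        (fderiv ℝ (v z.1) z.2 (EuclideanSpace.single 0 1) 2 ≠ 0 ∨ fderiv ℝ (v z.1) z.2 (EuclideanSpace.single 1 1) 2 ≠ 0) ∧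
        (fderiv ℝ (v z.1) z.2 (EuclideanSpace.single 2 1) 0 ≠ 0 ∨ fderiv ℝ (v z.1) z.2 (EuclideanSpace.single 2 1) 1 ≠ 0)) →
      ∃ W' : Set (ℝ × EuclideanSpace ℝ (Fin 3)), W' ⊆ W ∧ IsOpen W' ∧ W'.Nonempty ∧
        ((∃ e : EuclideanSpace ℝ (Fin 3), e ≠ 0 ∧ ∀ z ∈ W', fderiv ℝ (curl (v z.1)) z.2 e = 0) ∨
         (∃ c : EuclideanSpace ℝ (Fin 3), ∀ z ∈ W',
            fderiv ℝ (curl (v z.1)) z.2 (rotGen (z.2 - c)) = rotGen (curl (v z.1) z.2)))) :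
    ¬ IsBackwardSingularPoint v 0 := by
  -- the slab and the joint continuity of `curl v` and `Dv` on it
  set O : Set (ℝ × EuclideanSpace ℝ (Fin 3)) := Iio (0 : ℝ) ×ˢ univ with hO
  have hOo : IsOpen O := isOpen_Iio.prod isOpen_univ
  have hanV := analyticOnNhd_uncurry hcont (bdd_of_hasTypeITimeDecay hrate) hmild
  have hcurlc : ContinuousOn (uncurry fun s y => curl (v s) y) O := (analyticOnNhd_uncurry_curl hanV isOpen_Iio).continuousOn
  have hDc : ContinuousOn (uncurry fun s y => fderiv ℝ (v s) y) O :=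
    (analyticOnNhd_uncurry_fderiv_slice hanV isOpen_Iio).continuousOn
  -- the scalar entries `z ↦ D(v z.1)(z.2)[e_j]_i` are continuous on the slab
  have hent : ∀ (j i : Fin 3), ContinuousOn
      (fun z : ℝ × EuclideanSpace ℝ (Fin 3) => fderiv ℝ (v z.1) z.2 (EuclideanSpace.single j 1) i) O := by
    intro j i
    have h1 : ContinuousOn (fun z : ℝ × EuclideanSpace ℝ (Fin 3) =>
        fderiv ℝ (v z.1) z.2 (EuclideanSpace.single j 1)) O :=
      ((ContinuousLinearMap.apply ℝ (EuclideanSpace ℝ (Fin 3)) (EuclideanSpace.single j 1)).continuous).comp_continuousOn hDc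
    exact (EuclideanSpace.proj i).continuous.comp_continuousOn h1
  -- the non-degeneracy predicate
  set ND : ℝ × EuclideanSpace ℝ (Fin 3) → Prop := fun z => curl (v z.1) z.2 ≠ 0 ∧
      (fderiv ℝ (v z.1) z.2 (EuclideanSpace.single 0 1) 2 ≠ 0 ∨ fderiv ℝ (v z.1) z.2 (EuclideanSpace.single 1 1) 2 ≠ 0) ∧
      (fderiv ℝ (v z.1) z.2 (EuclideanSpace.single 2 1) 0 ≠ 0 ∨ fderiv ℝ (v z.1) z.2 (EuclideanSpace.single 2 1) 1 ≠ 0)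
    with hND
  by_cases hdeg : ∀ y : EuclideanSpace ℝ (Fin 3), ¬ ND (-1, y)
  · -- every point of the slice `s = −1` is degenerate: p7 g7's germ theorem
    refine nonflatLiouville_of_pointwise_degenerate_slice hrate hcont hmild hdiv (by norm_num : (-1 : ℝ) < 0)
      (hpol (-1) (by norm_num)) fun y => ?_
    have h := hdeg y
    simp only [hND, not_and_or, not_or, not_not] at h
    rcases h with h | h | h
    · exact Or.inl h
    · exact Or.inr (Or.inl ⟨h.1, h.2⟩)
    · exact Or.inr (Or.inr ⟨h.1, h.2⟩)
  · -- a non-degenerate point: the non-degenerate part of the slab is a nonempty open space–time set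
    push Not at hdeg
    obtain ⟨y₀, hy₀⟩ := hdeg
    set W : Set (ℝ × EuclideanSpace ℝ (Fin 3)) := {z | z ∈ O ∧ ND z} with hW
    have hWO : W ⊆ O := fun z hz => hz.1
    have hWne : W.Nonempty := ⟨(-1, y₀), ⟨mk_mem_prod (by norm_num : (-1 : ℝ) ∈ Iio 0) (mem_univ _), hy₀⟩⟩
    have hWopen : IsOpen W := by
      rw [isOpen_iff_mem_nhds]
      rintro z ⟨hzO, hA, hB, hCc⟩
      have hOz : O ∈ 𝓝 z := hOo.mem_nhds hzO
      -- each condition persists near `z`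
      have eA : ∀ᶠ w in 𝓝 z, curl (v w.1) w.2 ≠ 0 :=
        ((hcurlc z hzO).continuousAt hOz).eventually_ne hA
      have eB : ∀ᶠ w in 𝓝 z, fderiv ℝ (v w.1) w.2 (EuclideanSpace.single 0 1) 2 ≠ 0 ∨
          fderiv ℝ (v w.1) w.2 (EuclideanSpace.single 1 1) 2 ≠ 0 := by
        rcases hB with hB | hB
        · exact (((hent 0 2) z hzO).continuousAt hOz |>.eventually_ne hB).mono fun w hw => Or.inl hw
        · exact (((hent 1 2) z hzO).continuousAt hOz |>.eventually_ne hB).mono fun w hw => Or.inr hw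
      have eC : ∀ᶠ w in 𝓝 z, fderiv ℝ (v w.1) w.2 (EuclideanSpace.single 2 1) 0 ≠ 0 ∨
          fderiv ℝ (v w.1) w.2 (EuclideanSpace.single 2 1) 1 ≠ 0 := by
        rcases hCc with hCc | hCc
        · exact (((hent 2 0) z hzO).continuousAt hOz |>.eventually_ne hCc).mono fun w hw => Or.inl hw
        · exact (((hent 2 1) z hzO).continuousAt hOz |>.eventually_ne hCc).mono fun w hw => Or.inr hw
      have eO : ∀ᶠ w in 𝓝 z, w ∈ O := hOz
      filter_upwards [eO, eA, eB, eC] with w hwO hwA hwB hwC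
      exact ⟨hwO, hwA, hwB, hwC⟩
    obtain ⟨W', hW'W, hW'open, hW'ne, hsym⟩ := hLRC W hWopen hWne hWO fun z hz => hz.2
    have hW'O : W' ⊆ O := hW'W.trans hWO
    rcases hsym with ⟨e, he, htr⟩ | ⟨c, hrot⟩
    · -- translation branch: one slice of `W′` suffices
      obtain ⟨z₁, hz₁⟩ := hW'ne
      have hs : z₁.1 < 0 := (mem_prod.1 (hW'O hz₁)).1
      set U : Set (EuclideanSpace ℝ (Fin 3)) := {y | (z₁.1, y) ∈ W'} with hU
      have hUopen : IsOpen U := hW'open.preimage (Continuous.prodMk_right z₁.1)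
      have hUne : U.Nonempty := ⟨z₁.2, by simpa [hU] using hz₁⟩
      exact nonflatLiouville_of_local_curl_translation hrate hcont hmild hdiv hs he hUopen hUne
        fun y hy => htr (z₁.1, y) hy
    · -- rotation branch: the space–time open set `W′`
      exact nonflatLiouville_of_local_curl_rotation hrate hcont hmild hdiv hpol c hW'open hW'ne hW'O hrot

end Summit.NavierStokesRegularity.NavierStokesRegularity.Theorems.PoloidalWindowDoorPoloidalWindowRigidityK2OfLrc

end
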